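import Summits.BirchSwinnertonDyer.BirchSwinnertonDyer.Theorems.PrintCf2RubinValueTwoZetaSpanOfGenerators
import Literature.NumberTheory.NumberFields.UnramifiedCompositum
import Literature.NumberTheory.EllipticCurves.ZpExtensionUnramifiedProofs
import HarnessLib

/-!
# P4 (I-b) of the (LZ) blueprint — the SIGN input: an element of `θ′ = -1` under `K̃_n · K(𝔤₁)` from inertia at `𝔩 ∣ 𝔣`, `𝔩 ∤ p𝔤₁`

Cell `bsd-print-cf2`, width seat `bsd-line-cf2-p1-w3` g19 (GO by -w5 g11 18:21:04Z, text of
`HOME/bsd-line-cf2-p1-w5/P4Shapes_w5g11.lean` (I-b) VERBATIM as the conclusion); crux child `MainConjClauseAtSplitTwoQuadDA`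
(stmt-BirchSwinnertonDyer-24721), `--supports` helper; Theses-free; THEOREMS ONLY; 0 facts / 0 sorry.

Case (b) of -w5's (β5) trichotomy needs, for every tame `𝔩 ∣ 𝔣` (`𝔩 ∤ p`) missed by the auxiliary modulus `𝔤₁`, an
element `ρ ∈ Gal(K̄/K̃_n) ∩ Gal(K̄/K(𝔤₁))` with `θ′(ρ) = -1`. Take `ρ` in an inertia group above `𝔩` on which the quadratic
character `θ′` is non-trivial ((C-e): `θ′` ramified at `𝔩`, hypothesis `hram` in inertia currency): `ρ ∈ ker κᵢ ≤ κᵢ⁻¹(pⁿℤ_p)`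
(`ℤ_p`-extensions are unramified outside `p`, Washington 13.2 = the tree's `ZpExtension.inertia_le_kerSubgroup_holds`), and `ρ`
fixes `C_{𝔤₁}` pointwise (`C_{𝔤₁}` is unramified at `𝔩 ∤ 𝔤₁`: `isUnramifiedIn_rayClassField` + Lang's ramification theorem
`absRestrictNormalHom_eq_one_of_isUnramifiedIn`), and `θ′(ρ)² = 1`, `θ′(ρ) ≠ 1` force `θ′(ρ) = -1`.

* `inertia_le_galFixing_rayClassField_of_not_le` — `I_𝔓 ≤ Gal(K̄/C_{𝔤₁})` for `𝔓 ∣ 𝔩 ∤ 𝔤₁` (also the inertia source of -w2's (H2));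
* `inertia_le_pairLayerSubgroup_of_not_mem` — `I_𝔓 ≤ Gal(K̄/K̃_n)` for `𝔓 ∣ 𝔩 ∤ p`;
* `units_eq_neg_one_of_sq_eq_one_of_ne_one` — in `ℤ_pˣ`: `u² = 1`, `u ≠ 1 ⟹ u = -1`;
* ★★ `exists_mem_pairLayerSubgroup_inf_galFixing_rayClassField_apply_eq_neg_one` — (I-b) VERBATIM under `hθ2`, `hram`.

HONEST FRAMING: closes nothing by itself; no summit statement is proved by this seat; BSD is not proved by any of this.

## References
* [Washington1997] L. C. Washington, *Introduction to Cyclotomic Fields*, Prop. 13.2.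
* [NeukirchANT1999] J. Neukirch, *Algebraic Number Theory*, Ch. VI §6 (6.2)/(6.6) (conductor of `K^𝔪`), VII §10 (10.6).
-/

-- the summit namespace `Summit.BirchSwinnertonDyer.BirchSwinnertonDyer` repeats the problem name by design (D-0017)
set_option linter.dupNamespace false
set_option autoImplicit false

noncomputable section

open scoped Classical NumberField
open Field IsDedekindDomain IntermediateField NumberField
open Literature.NumberTheory.NumberFields
open Literature.NumberTheory.GaloisRepresentations Literature.NumberTheory.GaloisRepresentations.LocalWeilDatum
open Literature.NumberTheory.EllipticCurves
open Literature.NumberTheory.ComplexMultiplication.EllipticUnits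
open Literature.NumberTheory.ComplexMultiplication.EllipticUnits.JohnsonLeungKings2011

namespace Summit.BirchSwinnertonDyer.BirchSwinnertonDyer.Theorems.PrintCf2.ZetaSpanSignInput

variable {K : Type} [Field K] [NumberField K] (p : ℕ) [Fact p.Prime]

/-- **`I_𝔓 ≤ Gal(K̄/C_{𝔤₁})` for a prime `𝔓` of `K̄` above `𝔩 ∤ 𝔤₁`** (`𝔤₁ ≠ 0`): the ray class field `C_{𝔤₁}` is unramified
at `𝔩` (Neukirch VI (6.6)), so every inertia group above `𝔩` acts trivially on it (Lang's ramification theorem in the tree's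
form `absRestrictNormalHom_eq_one_of_isUnramifiedIn`). [cite: NeukirchANT1999, Ch. VI §6 Cor. (6.6), Ch. VII §10 Thm. (10.6)] -/
theorem inertia_le_galFixing_rayClassField_of_not_le {𝔤₁ : Ideal (𝓞 K)} (h𝔤₁ : 𝔤₁ ≠ ⊥)
    {𝔩 : HeightOneSpectrum (𝓞 K)} (h𝔩 : ¬ 𝔤₁ ≤ 𝔩.asIdeal)
    {𝔓 : Ideal (absIntegers (𝓞 K) K)} (h𝔓 : 𝔓 ∈ 𝔩.primesAbove) :
    𝔓.inertia (absoluteGaloisGroup K) ≤ galFixing K (rayClassField K 𝔤₁) := by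
  intro ρ hρ
  have hunr := isUnramifiedIn_rayClassField (K := K) h𝔤₁ h𝔩
  have h1 := absRestrictNormalHom_eq_one_of_isUnramifiedIn (rayClassField K 𝔤₁) hunr h𝔓 hρ
  rw [absRestrictNormalHom_eq_one_iff_forall_smul] at h1
  rw [mem_galFixing_iff]
  intro x hx
  exact h1 ⟨x, hx⟩

/-- **`I_𝔓 ≤ Gal(K̄/K̃_n)` for a prime `𝔓` of `K̄` above `𝔩 ∤ p`**: `ℤ_p`-extensions are unramified outside `p`
(`I_𝔓 ≤ ker κᵢ`, Washington Prop. 13.2 = `ZpExtension.inertia_le_kerSubgroup_holds`) and `ker κᵢ ≤ κᵢ⁻¹(pⁿℤ_p)`.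
[cite: Washington1997, Prop. 13.2] -/
theorem inertia_le_pairLayerSubgroup_of_not_mem (κ₁ κ₂ : ZpExtension K p) (n : ℕ)
    {𝔩 : HeightOneSpectrum (𝓞 K)} (hp𝔩 : ((p : ℕ) : 𝓞 K) ∉ 𝔩.asIdeal)
    {𝔓 : Ideal (absIntegers (𝓞 K) K)} (h𝔓 : 𝔓 ∈ 𝔩.primesAbove) :
    𝔓.inertia (absoluteGaloisGroup K) ≤ JohnsonLeungKings2011.pairLayerSubgroup κ₁ κ₂ n := fun _ hρ ↦
  ⟨κ₁.kerSubgroup_le_layerSubgroup n (ZpExtension.inertia_le_kerSubgroup_holds K p κ₁ hp𝔩 h𝔓 hρ),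
    κ₂.kerSubgroup_le_layerSubgroup n (ZpExtension.inertia_le_kerSubgroup_holds K p κ₂ hp𝔩 h𝔓 hρ)⟩

/-- In `ℤ_pˣ`: `u² = 1` and `u ≠ 1` force `u = -1` (`ℤ_p` is a domain). [cite: Washington1997, Prop. 13.2] -/
theorem units_eq_neg_one_of_sq_eq_one_of_ne_one {u : ℤ_[p]ˣ} (h2 : u ^ 2 = 1) (h1 : u ≠ 1) :
    u = -1 := by
  have h : (u : ℤ_[p]) ^ 2 = 1 := by rw [← Units.val_pow_eq_pow_val, h2, Units.val_one]
  rcases sq_eq_one_iff.mp h with h' | h'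
  · exact absurd (Units.ext h') h1
  · exact Units.ext h'

/-- ★★ **P4 (I-b), the SIGN input of the (β5) trichotomy**: for a character `θ′ : Γ_K →ₜ* ℤ_pˣ` with `θ′² = 1` which is
RAMIFIED at every tame place of the modulus (`hram`: some inertia element above each `𝔩 ∣ 𝔣`, `𝔩 ∤ p`, has `θ′ ≠ 1` — the
class's (C-e) «`𝔣^{(p′)}` is the conductor of `θ′`»), every auxiliary modulus `𝔤₁ ≠ 0` missing such an `𝔩` admits
`ρ ∈ Gal(K̄/K̃_n) ⊓ Gal(K̄/C_{𝔤₁})` with `θ′(ρ) = -1`. [cite: Washington1997, Prop. 13.2] [cite: NeukirchANT1999, Ch. VI §6 Cor. (6.6)] -/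
theorem exists_mem_pairLayerSubgroup_inf_galFixing_rayClassField_apply_eq_neg_one
    (κ₁ κ₂ : ZpExtension K p) (θ' : absoluteGaloisGroup K →ₜ* ℤ_[p]ˣ) (𝔣 : Ideal (𝓞 K))
    (hθ2 : ∀ σ : absoluteGaloisGroup K, θ' σ ^ 2 = 1)
    (hram : ∀ 𝔩 : HeightOneSpectrum (𝓞 K), 𝔩 ∈ suppPF p 𝔣 → ((p : ℕ) : 𝓞 K) ∉ 𝔩.asIdeal →
      ∃ 𝔓 ∈ 𝔩.primesAbove, ∃ ρ ∈ 𝔓.inertia (absoluteGaloisGroup K), θ' ρ ≠ 1) :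
    ∀ (𝔩 : HeightOneSpectrum (𝓞 K)), 𝔩 ∈ suppPF p 𝔣 → ((p : ℕ) : 𝓞 K) ∉ 𝔩.asIdeal →
      ∀ (𝔤₁ : Ideal (𝓞 K)) (n : ℕ), 𝔤₁ ≠ ⊥ → ¬ 𝔤₁ ≤ 𝔩.asIdeal →
        ∃ ρ ∈ JohnsonLeungKings2011.pairLayerSubgroup κ₁ κ₂ n ⊓ galFixing K (rayClassField K 𝔤₁), θ' ρ = -1 := by
  intro 𝔩 h𝔩 hp𝔩 𝔤₁ n h𝔤₁ h𝔤₁𝔩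
  obtain ⟨𝔓, h𝔓, ρ, hρ, hθρ⟩ := hram 𝔩 h𝔩 hp𝔩
  exact ⟨ρ, ⟨inertia_le_pairLayerSubgroup_of_not_mem p κ₁ κ₂ n hp𝔩 h𝔓 hρ,
    inertia_le_galFixing_rayClassField_of_not_le h𝔤₁ h𝔤₁𝔩 h𝔓 hρ⟩,
    units_eq_neg_one_of_sq_eq_one_of_ne_one (p := p) (hθ2 ρ) hθρ⟩

end Summit.BirchSwinnertonDyer.BirchSwinnertonDyer.Theorems.PrintCf2.ZetaSpanSignInput

end
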